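import Mathlib.RingTheory.MvPolynomial.WeightedHomogeneous
import Summits.ValiantsHypothesis.ValiantsHypothesis.Theorems.RigidityForcesSymmetryGrenetFirstOrderRankRigidAdjugate

/-!
# Route RigidityForcesSymmetry — `GrenetFirstOrderRankRigid` (item stmt-ValiantsHypothesis-21029),
line `grenet_gauge`: stub `stub_linearRigid`, step 4 — torus weights split the tangency identity

For the crux line `Cruxes/GrenetFirstOrderRankRigid/Lines/grenet_gauge.lean` (blueprint
`Lines/grenet_gauge-stub_linearRigid-PROOF.md`, §4).  The two-sided torus `x_{j,c} ↦ d_j e_c x_{j,c}`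
grades `k[x]` by any pair of weight vectors: for an additive monoid `M` and `a b : Fin n → M` put
`w (j, c) := a j + b c`.  Then

* `grenet_W_isWeightedHomogeneous` — every entry `W S T` of the lattice-path matrix
  `W = adj(1 - adj)` of Grenet's branching program is `w`-homogeneous of degree
  `D S T := Σ_{j ∈ T \ S} a j + Σ_{|S| ≤ c < |T|} b c` (a path `S → T` inserts the elements of `T \ S`
  at the levels `|S|, …, |T| - 1`);
* `grenet_cofactorTerm_isWeightedHomogeneous` — hence, for an entry `(i, j)` and a variable
  `v = (p, q)`, the polynomial `per_n · W (C j) (R i) · x_v - W ∅ (R i) · x_v · W (C j) univ` (the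
  coefficient of `(A'_v) i j` in the tangency functional, `trace_grenet_adjugate_mul`) is
  `w`-homogeneous of the ENTRY WEIGHT
  `E i j v := (Σ_{j' ∈ R i} a j' + Σ_{j' ∉ C j} a j' + a p) + (Σ_{c < |R i|} b c + Σ_{c ≥ |C j|} b c + b q)`;
* `sum_filter_eq_zero_of_isWeightedHomogeneous` — a vanishing sum of weighted-homogeneous
  polynomials vanishes weight by weight (`weightedHomogeneousComponent` is linear);
* `grenet_tangency_weightSplit` — **so the tangency identity of a homogeneous direction
  `Σ_v x_v A'_v` at Grenet's pencil splits into one identity per weight `m`**: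
  `Σ_{(i,j,v) : E i j v = m} (A'_v) i j · (per_n · W (C j) (R i) · x_v - W ∅ (R i) · x_v · W (C j) univ) = 0`.
  With `M = ℤⁿ × ℤⁿ`-valued indicator weights these are the blocks `(A, B, k)` of the blueprint.

No new definitions (the weights enter as the parameters `a, b`).  VP ≠ VNP is not moved by this
file (bookkeeping for a first-order statement about one explicit matrix family).
-/

noncomputable section

open MvPolynomial Matrix Finset

namespace Summit.ValiantsHypothesis.Theorems.RigidityForcesSymmetry.GrenetGauge

open Literature.Computability.AlgebraicComplexity

/-! ### A vanishing sum of weighted-homogeneous polynomials vanishes weight by weight -/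

section Generic

variable {R : Type*} [CommSemiring R] {σ M : Type*} [AddCommMonoid M]

/-- **Weight splitting.** If `Σ_{i ∈ s} f i = 0` and each `f i` is weighted homogeneous of weight
`d i`, then for every weight `m` the partial sum over `{i : d i = m}` vanishes (apply the linear
projection `weightedHomogeneousComponent w m`). [folklore] -/
theorem sum_filter_eq_zero_of_isWeightedHomogeneous [DecidableEq M] {ι : Type*} (s : Finset ι)
    (f : ι → MvPolynomial σ R) (d : ι → M) (w : σ → M)
    (hf : ∀ i ∈ s, IsWeightedHomogeneous w (f i) (d i)) (h0 : ∑ i ∈ s, f i = 0) (m : M) :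
    ∑ i ∈ s.filter (fun i => d i = m), f i = 0 := by
  have h := congrArg (weightedHomogeneousComponent w m) h0
  rw [map_sum, map_zero] at h
  rw [Finset.sum_filter]
  refine Eq.trans (Finset.sum_congr rfl fun i hi => ?_) h
  rw [weightedHomogeneousComponent_of_mem (hf i hi)]
  by_cases hdm : d i = m
  · rw [if_pos hdm, if_pos hdm.symm]
  · rw [if_neg hdm, if_neg fun h' => hdm h'.symm]

end Generic

/-! ### The lattice-path matrix is bihomogeneous for the two-sided torus -/

section PathWeights

variable (k : Type*) [CommRing k] {n : ℕ} {M : Type*} [AddCommMonoid M] (a b : Fin n → M)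

/-- The arc weight `wt j c` (`= x_{j,c}` for `c < n`) is homogeneous of weight `a j + b c`.
[cite: Grenet2011, Thm. 1] -/
theorem grenet_wt_isWeightedHomogeneous (j : Fin n) {c : ℕ} (hc : c < n) :
    IsWeightedHomogeneous (fun v : Fin n × Fin n => a v.1 + b v.2) (Grenet.wt k n j c) (a j + b ⟨c, hc⟩) := by
  unfold Grenet.wt
  rw [dif_pos hc]
  exact isWeightedHomogeneous_X k _ (j, (⟨c, hc⟩ : Fin n))

/-- **A path product is homogeneous of the weight of its endpoints.** For an injective
`g : Fin m → Fin n` avoiding `S` with `S ∪ im g = T`, the path product `Π_t wt (g t) (|S| + t)` is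
homogeneous of weight `Σ_{j ∈ T \ S} a j + Σ_{|S| ≤ c < |T|} b c`. [cite: Grenet2012Thesis, Lemme 3.17] -/
theorem grenet_pathProd_isWeightedHomogeneous {m : ℕ} {S T : Finset (Fin n)} {g : Fin m → Fin n}
    (hg : Function.Injective g) (hgS : ∀ t, g t ∉ S) (hST : S ∪ univ.image g = T) :
    IsWeightedHomogeneous (fun v : Fin n × Fin n => a v.1 + b v.2)
      (∏ t : Fin m, Grenet.wt k n (g t) (S.card + t))
      (∑ j ∈ T \ S, a j + ∑ c ∈ univ.filter (fun c : Fin n => S.card ≤ (c : ℕ) ∧ (c : ℕ) < T.card), b c) := by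
  -- cardinalities: `|T| = |S| + m ≤ n`
  have himg : univ.image g = T \ S := by
    rw [← hST, Finset.union_sdiff_left]
    symm
    rw [Finset.sdiff_eq_self_iff_disjoint]
    exact Finset.disjoint_left.mpr fun x hx hxS => by
      obtain ⟨t, -, rfl⟩ := Finset.mem_image.mp hx
      exact hgS t hxS
  have hcardT : T.card = S.card + m := by
    rw [← hST, Finset.card_union_of_disjoint (Finset.disjoint_left.mpr fun x hxS hx => by
      obtain ⟨t, -, rfl⟩ := Finset.mem_image.mp hx
      exact hgS t hxS), Finset.card_image_of_injective _ hg, Finset.card_univ, Fintype.card_fin]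
  have hle : S.card + m ≤ n := by
    rw [← hcardT]
    exact (Finset.card_le_univ T).trans_eq (Fintype.card_fin n)
  -- each factor is a variable of the right weight
  have hfac : ∀ t : Fin m, IsWeightedHomogeneous (fun v : Fin n × Fin n => a v.1 + b v.2)
      (Grenet.wt k n (g t) (S.card + t)) (a (g t) + b ⟨S.card + t, by omega⟩) :=
    fun t => grenet_wt_isWeightedHomogeneous k a b (g t) (by omega)
  have hprod := IsWeightedHomogeneous.prod univ (fun t => Grenet.wt k n (g t) (S.card + t))
    (fun t => a (g t) + b ⟨S.card + t, by omega⟩) fun t _ => hfac t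
  -- the total weight
  have hsum : ∑ t : Fin m, (a (g t) + b ⟨S.card + (t : ℕ), by omega⟩)
      = ∑ j ∈ T \ S, a j + ∑ c ∈ univ.filter (fun c : Fin n => S.card ≤ (c : ℕ) ∧ (c : ℕ) < T.card), b c := by
    rw [Finset.sum_add_distrib]
    congr 1
    · rw [← himg, Finset.sum_image fun x _ y _ h => hg h]
    · -- reindex the levels `c = |S| + t`
      refine Finset.sum_bij (fun t _ => (⟨S.card + (t : ℕ), by omega⟩ : Fin n)) ?_ ?_ ?_ ?_
      · intro t _
        simp only [Finset.mem_filter, Finset.mem_univ, true_and]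
        constructor <;> omega
      · intro t₁ _ t₂ _ h
        simp only [Fin.mk.injEq] at h
        exact Fin.ext (by omega)
      · intro c hc
        simp only [Finset.mem_filter, Finset.mem_univ, true_and] at hc
        exact ⟨⟨(c : ℕ) - S.card, by omega⟩, Finset.mem_univ _, Fin.ext (by simp only; omega)⟩
      · intro t _
        rfl
  rw [← hsum]
  exact hprod

/-- **The powers of Grenet's adjacency matrix are bihomogeneous**: `(adj ^ m) S T` is homogeneous of
weight `Σ_{j ∈ T \ S} a j + Σ_{|S| ≤ c < |T|} b c`. [cite: Grenet2012Thesis, Lemme 3.17] -/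
theorem grenet_adj_pow_isWeightedHomogeneous (m : ℕ) (S T : Finset (Fin n)) :
    IsWeightedHomogeneous (fun v : Fin n × Fin n => a v.1 + b v.2) ((Grenet.adj k n ^ m) S T)
      (∑ j ∈ T \ S, a j + ∑ c ∈ univ.filter (fun c : Fin n => S.card ≤ (c : ℕ) ∧ (c : ℕ) < T.card), b c) := by
  rw [Grenet.pow_apply (Grenet.wt k n) (grenet_adj_shape k n)]
  refine IsWeightedHomogeneous.sum univ _ _ fun g _ => ?_
  split_ifs with h
  · exact grenet_pathProd_isWeightedHomogeneous k a b h.1 h.2.1 h.2.2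
  · exact isWeightedHomogeneous_zero k _ _

/-- **The lattice-path matrix `W = adj(1 - adj)` is bihomogeneous**: `W S T` is homogeneous of
weight `D S T = Σ_{j ∈ T \ S} a j + Σ_{|S| ≤ c < |T|} b c`. [cite: Grenet2011, Thm. 1] -/
theorem grenet_W_isWeightedHomogeneous (S T : Finset (Fin n)) :
    IsWeightedHomogeneous (fun v : Fin n × Fin n => a v.1 + b v.2) ((1 - Grenet.adj k n).adjugate S T)
      (∑ j ∈ T \ S, a j + ∑ c ∈ univ.filter (fun c : Fin n => S.card ≤ (c : ℕ) ∧ (c : ℕ) < T.card), b c) := by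
  rw [Grenet.adjugate_one_sub (Grenet.wt k n) (grenet_adj_shape k n), Matrix.sum_apply]
  exact IsWeightedHomogeneous.sum _ _ _ fun m _ => grenet_adj_pow_isWeightedHomogeneous k a b m S T

/-- The permanent `per_n = W ∅ univ` is homogeneous of weight `Σ_j a j + Σ_c b c`.
[cite: Grenet2011, Thm. 1] -/
theorem perPoly_isWeightedHomogeneous :
    IsWeightedHomogeneous (fun v : Fin n × Fin n => a v.1 + b v.2) (perPoly (Fin n) k)
      (∑ j, a j + ∑ c, b c) := by
  have h := grenet_W_isWeightedHomogeneous k a b ∅ univ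
  rw [grenet_W_empty_univ, Finset.sdiff_empty, Finset.card_empty, Finset.card_univ, Fintype.card_fin] at h
  have hf : univ.filter (fun c : Fin n => 0 ≤ (c : ℕ) ∧ (c : ℕ) < n) = univ :=
    Finset.filter_true_of_mem fun c _ => ⟨Nat.zero_le _, c.isLt⟩
  rwa [hf] at h

end PathWeights

/-! ### The entry weights and the splitting of the tangency identity -/

section Split

variable {k : Type*} [CommRing k] {n N : ℕ} (e : Finset (Fin n) ≃ Fin (N + 1))
  {M : Type*} [AddCommMonoid M] (a b : Fin n → M)

/-- Weight bookkeeping for the closed-walk term: for `T ⊆ S`,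
`D ∅ univ + D T S = (Σ_{j∈S} a + Σ_{j∉T} a) + (Σ_{c<|S|} b + Σ_{c≥|T|} b)`. [folklore] -/
theorem weight_per_mul_W {S T : Finset (Fin n)} (hTS : T ⊆ S) :
    (∑ j, a j + ∑ c, b c) +
        (∑ j ∈ S \ T, a j + ∑ c ∈ univ.filter (fun c : Fin n => T.card ≤ (c : ℕ) ∧ (c : ℕ) < S.card), b c)
      = (∑ j ∈ S, a j + ∑ j ∈ Tᶜ, a j) +
        (∑ c ∈ univ.filter (fun c : Fin n => (c : ℕ) < S.card), b c
          + ∑ c ∈ univ.filter (fun c : Fin n => T.card ≤ (c : ℕ)), b c) := by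
  have hTS' : T.card ≤ S.card := Finset.card_le_card hTS
  have ha : ∑ j, a j + ∑ j ∈ S \ T, a j = ∑ j ∈ S, a j + ∑ j ∈ Tᶜ, a j := by
    rw [← Finset.sum_add_sum_compl S a, add_assoc]
    congr 1
    rw [← Finset.sum_union (Finset.disjoint_left.mpr fun x hx hx' => (Finset.mem_compl.mp hx) (Finset.mem_sdiff.mp hx').1)]
    refine Finset.sum_congr ?_ fun _ _ => rfl
    ext x
    simp only [Finset.mem_union, Finset.mem_compl, Finset.mem_sdiff]
    constructor
    · rintro (h | ⟨h1, h2⟩)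
      · exact fun hT => h (hTS hT)
      · exact h2
    · intro h
      by_cases hx : x ∈ S
      · exact Or.inr ⟨hx, h⟩
      · exact Or.inl hx
  have hb : ∑ c, b c + ∑ c ∈ univ.filter (fun c : Fin n => T.card ≤ (c : ℕ) ∧ (c : ℕ) < S.card), b c
      = ∑ c ∈ univ.filter (fun c : Fin n => (c : ℕ) < S.card), b c
          + ∑ c ∈ univ.filter (fun c : Fin n => T.card ≤ (c : ℕ)), b c := by
    rw [← Finset.sum_filter_add_sum_filter_not univ (fun c : Fin n => (c : ℕ) < S.card) b, add_assoc]
    congr 1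
    rw [← Finset.sum_union]
    · refine Finset.sum_congr ?_ fun _ _ => rfl
      ext c
      simp only [Finset.mem_union, Finset.mem_filter, Finset.mem_univ, true_and, not_lt]
      omega
    · exact Finset.disjoint_left.mpr fun c h1 h2 => by
        simp only [Finset.mem_filter, Finset.mem_univ, true_and, not_lt] at h1 h2
        omega
  rw [add_add_add_comm, ha, hb]

/-- Weight bookkeeping for the through-path term:
`D ∅ S + D T univ = (Σ_{j∈S} a + Σ_{j∉T} a) + (Σ_{c<|S|} b + Σ_{c≥|T|} b)`. [folklore] -/
theorem weight_W_mul_W (S T : Finset (Fin n)) :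
    (∑ j ∈ S \ ∅, a j + ∑ c ∈ univ.filter (fun c : Fin n => (∅ : Finset (Fin n)).card ≤ (c : ℕ) ∧ (c : ℕ) < S.card), b c)
      + (∑ j ∈ univ \ T, a j + ∑ c ∈ univ.filter (fun c : Fin n => T.card ≤ (c : ℕ) ∧ (c : ℕ) < (univ : Finset (Fin n)).card), b c)
      = (∑ j ∈ S, a j + ∑ j ∈ Tᶜ, a j) +
        (∑ c ∈ univ.filter (fun c : Fin n => (c : ℕ) < S.card), b c
          + ∑ c ∈ univ.filter (fun c : Fin n => T.card ≤ (c : ℕ)), b c) := by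
  rw [Finset.sdiff_empty, Finset.card_empty, Finset.card_univ, Fintype.card_fin, Finset.compl_eq_univ_sdiff,
    add_add_add_comm]
  congr 1
  congr 1
  · exact Finset.sum_congr (Finset.filter_congr fun c _ => by simp) fun _ _ => rfl
  · exact Finset.sum_congr (Finset.filter_congr fun c _ => by simp [c.isLt]) fun _ _ => rfl

/-- **The cofactor term of an entry is homogeneous of the entry weight.** For vertices `S` (row),
`T` (column) and a variable `v = (p, q)`, the polynomial
`per_n · W T S · x_v - W ∅ S · x_v · W T univ` is homogeneous of weight
`E S T v := (Σ_{j∈S} a j + Σ_{j∉T} a j + a p) + (Σ_{c<|S|} b c + Σ_{c≥|T|} b c + b q)`.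
[cite: Grenet2011, Thm. 1] -/
theorem grenet_cofactorTerm_isWeightedHomogeneous (S T : Finset (Fin n)) (v : Fin n × Fin n) :
    IsWeightedHomogeneous (fun v : Fin n × Fin n => a v.1 + b v.2)
      (perPoly (Fin n) k * (1 - Grenet.adj k n).adjugate T S * X v
        - (1 - Grenet.adj k n).adjugate ∅ S * X v * (1 - Grenet.adj k n).adjugate T univ)
      ((∑ j ∈ S, a j + ∑ j ∈ Tᶜ, a j) +
        (∑ c ∈ univ.filter (fun c : Fin n => (c : ℕ) < S.card), b c
          + ∑ c ∈ univ.filter (fun c : Fin n => T.card ≤ (c : ℕ)), b c) + (a v.1 + b v.2)) := by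
  refine (weightedHomogeneousSubmodule k (fun v : Fin n × Fin n => a v.1 + b v.2) _).sub_mem ?_ ?_
  · by_cases hTS : T ⊆ S
    · rw [← weight_per_mul_W a b hTS]
      exact ((perPoly_isWeightedHomogeneous k a b).mul (grenet_W_isWeightedHomogeneous k a b T S)).mul
        (isWeightedHomogeneous_X k _ v)
    · -- no path `T → S`: the term vanishes
      have hW : (1 - Grenet.adj k n).adjugate T S = 0 := by
        rw [Grenet.adjugate_one_sub (Grenet.wt k n) (grenet_adj_shape k n), Matrix.sum_apply]
        refine Finset.sum_eq_zero fun m _ => ?_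
        rw [Grenet.pow_apply (Grenet.wt k n) (grenet_adj_shape k n)]
        refine Finset.sum_eq_zero fun g _ => if_neg ?_
        rintro ⟨-, -, h⟩
        exact hTS (h ▸ Finset.subset_union_left)
      rw [hW, mul_zero, zero_mul]
      exact isWeightedHomogeneous_zero k _ _
  · rw [← weight_W_mul_W a b S T, add_right_comm]
    exact ((grenet_W_isWeightedHomogeneous k a b ∅ S).mul (isWeightedHomogeneous_X k _ v)).mul
      (grenet_W_isWeightedHomogeneous k a b T univ)

/-- **The tangency identity of a homogeneous direction, entry by entry.** For a homogeneous
direction `Σ_v x_v A'_v` at Grenet's pencil,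
`tr(adj(x̃) · Σ_v x_v A'_v) = ε · Σ_{(i,j,v)} (A'_v) i j · (per_n · W (C j) (R i) · x_v - W ∅ (R i) · x_v · W (C j) univ)`.
[cite: Grenet2011, Thm. 1] -/
theorem trace_grenet_adjugate_mul_homogeneous [IsDomain k] (hn : n ≠ 0) (hN : 2 ^ n = N + 1)
    (A' : Fin n × Fin n → Matrix (Fin N) (Fin N) k) :
    ((Grenet.repr k n e).adjugate * ∑ v, (X v : MvPolynomial (Fin n × Fin n) k) • (A' v).map C).trace
      = (-1 : MvPolynomial (Fin n × Fin n) k) ^ ((e univ : ℕ) + (e ∅ : ℕ)) *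
        ∑ x : Fin N × Fin N × (Fin n × Fin n), C (A' x.2.2 x.1 x.2.1) *
          (perPoly (Fin n) k * (1 - Grenet.adj k n).adjugate (e.symm ((e ∅).succAbove x.2.1)) (e.symm ((e univ).succAbove x.1)) * X x.2.2
            - (1 - Grenet.adj k n).adjugate ∅ (e.symm ((e univ).succAbove x.1)) * X x.2.2
              * (1 - Grenet.adj k n).adjugate (e.symm ((e ∅).succAbove x.2.1)) univ) := by
  rw [trace_grenet_adjugate_mul e hn hN]
  congr 1
  simp only [Fintype.sum_prod_type, Matrix.sum_apply, Finset.mul_sum, Matrix.smul_apply, Matrix.map_apply,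
    smul_eq_mul]
  refine Finset.sum_congr rfl fun i _ => Finset.sum_congr rfl fun j _ =>
    Finset.sum_congr rfl fun p _ => Finset.sum_congr rfl fun q _ => ?_
  ring

/-- **Weight splitting of the tangency identity** (blueprint §4).  If the homogeneous direction
`Σ_v x_v A'_v` is Zariski-tangent at Grenet's pencil, `tr(adj(x̃) · Σ_v x_v A'_v) = 0`, then for EVERY
additive weight `w (j,c) = a j + b c` and every value `m`, the entries of entry weight `m` satisfy
`Σ_{(i,j,v) : E (R i) (C j) v = m} (A'_v) i j · (per_n · W (C j) (R i) · x_v - W ∅ (R i) · x_v · W (C j) univ) = 0`.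
Taking indicator weights (`M = ℤⁿ × ℤⁿ`) these are the weight blocks `(A, B, k)` of the line's
blueprint. [cite: Grenet2011, Thm. 1] -/
theorem grenet_tangency_weightSplit [IsDomain k] [DecidableEq M] (hn : n ≠ 0) (hN : 2 ^ n = N + 1)
    (A' : Fin n × Fin n → Matrix (Fin N) (Fin N) k)
    (htr : ((Grenet.repr k n e).adjugate * ∑ v, (X v : MvPolynomial (Fin n × Fin n) k) • (A' v).map C).trace = 0)
    (m : M) :
    ∑ x ∈ (univ : Finset (Fin N × Fin N × (Fin n × Fin n))).filter (fun x =>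
        (∑ j ∈ e.symm ((e univ).succAbove x.1), a j + ∑ j ∈ (e.symm ((e ∅).succAbove x.2.1))ᶜ, a j) +
          (∑ c ∈ univ.filter (fun c : Fin n => (c : ℕ) < (e.symm ((e univ).succAbove x.1)).card), b c
            + ∑ c ∈ univ.filter (fun c : Fin n => (e.symm ((e ∅).succAbove x.2.1)).card ≤ (c : ℕ)), b c)
          + (a x.2.2.1 + b x.2.2.2) = m),
      C (A' x.2.2 x.1 x.2.1) *
        (perPoly (Fin n) k * (1 - Grenet.adj k n).adjugate (e.symm ((e ∅).succAbove x.2.1)) (e.symm ((e univ).succAbove x.1)) * X x.2.2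
          - (1 - Grenet.adj k n).adjugate ∅ (e.symm ((e univ).succAbove x.1)) * X x.2.2
            * (1 - Grenet.adj k n).adjugate (e.symm ((e ∅).succAbove x.2.1)) univ) = 0 := by
  rw [trace_grenet_adjugate_mul_homogeneous e hn hN] at htr
  have hε : IsUnit ((-1 : MvPolynomial (Fin n × Fin n) k) ^ ((e univ : ℕ) + (e ∅ : ℕ))) :=
    (isUnit_one.neg).pow _
  rw [hε.mul_right_eq_zero] at htr
  refine sum_filter_eq_zero_of_isWeightedHomogeneous univ _ _ (fun v : Fin n × Fin n => a v.1 + b v.2)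
    (fun x _ => ?_) htr m
  exact (grenet_cofactorTerm_isWeightedHomogeneous a b _ _ x.2.2).C_mul _

end Split

end Summit.ValiantsHypothesis.Theorems.RigidityForcesSymmetry.GrenetGauge
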